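import Mathlib

/-!
# Bessel count for the `Q + 1` directions of `M₂(K)`
# (crux `LevelGradedCohnUmans.GradedDesignFamily`, stmt-MatrixMultiplication-7610; negative side,
# line `quadratic-extension-level-one-cell`, stub `gl2Flat_bessel_count`)

For a finite field `K` with `Q := |K|` and a finite set `Γ ⊆ M₂(K)` of `2 × 2` matrices put
`N₂ := Σ_{u ∈ K²} #{(x, y) ∈ Γ² : x u = y u}`.  Then

* `gl2Flat_bessel_count` — `Q · N₂ ≤ Q |Γ|² + (Q - 1) (|Γ|² + Q³ |Γ|)`.

Proof.  The direction `u = 0` contributes `|Γ|²`; every `u ≠ 0` is a nonzero multiple of exactly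
one of the `Q + 1` representatives `r none := (0, 1)`, `r (some t) := (1, t)`, and the count only
depends on the line through `u`, so `N₂ = |Γ|² + (Q - 1) Σ_i F_i` with
`F_i := #{(x, y) ∈ Γ² : x rᵢ = y rᵢ} = Σ_w nᵢ(w)²`, `nᵢ(w) := #{x ∈ Γ : x rᵢ = w}`
(`gl2Flat_bessel_count_directions`).  For `i ≠ j` the map `x ↦ (x rᵢ, x rⱼ)` is a bijection
`M₂(K) → K² × K²` (`gl2Flat_bessel_count_pair_bijective`), so the `Q + 1` partitions of `M₂(K)`
into the fibres of `x ↦ x rᵢ` are mutually orthogonal equipartitions: the functions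
`gᵢ(x) := Q² nᵢ(x rᵢ) - |Γ|` are orthogonal to the constants and to each other.  Bessel's
inequality for the orthogonal family `{1} ∪ {gᵢ}` against the indicator function of `Γ`
(`gl2Flat_bessel_count_bessel`, in the division-free form
`2 t Σ cᵢ ⟨f, gᵢ⟩ ≤ t² ⟨f, f⟩ + Σ cᵢ² ⟨gᵢ, gᵢ⟩`) gives `Q Σ_i F_i ≤ Q³ |Γ| + |Γ|²`
(`gl2Flat_bessel_count_rep_sum_le`), and the claim follows.  This is the expander-mixing bound
for the bilinear-forms graph on `M₂(K)` (rank-one differences), proved from first principles.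

Sorry-free; axioms `propext`, `Classical.choice`, `Quot.sound`.
-/

set_option linter.dupNamespace false

open scoped BigOperators

namespace Summit.MatrixMultiplication.MatrixMultiplication.Theorems.GradedDesignFamily.Negative

/-- **Bessel's inequality, division-free form.**  For a finite family `g i` of pairwise orthogonal
real functions on a finite type (`Σ_x g i x * g j x = 0` for `i ≠ j`), any `f`, any `t` and any
coefficients `c i`: `2 t Σ_i c_i ⟨f, g_i⟩ ≤ t² ⟨f, f⟩ + Σ_i c_i² ⟨g_i, g_i⟩`, because the
difference is `‖t f - Σ_i c_i g_i‖² ≥ 0`. [folklore] -/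
theorem gl2Flat_bessel_count_bessel {X ι : Type*} [Fintype X] [Fintype ι]
    (f : X → ℝ) (g : ι → X → ℝ) (t : ℝ) (c : ι → ℝ)
    (horth : ∀ i j, i ≠ j → ∑ x, g i x * g j x = 0) :
    2 * t * ∑ i, c i * ∑ x, f x * g i x ≤
      t ^ 2 * ∑ x, f x ^ 2 + ∑ i, c i ^ 2 * ∑ x, g i x ^ 2 := by
  classical
  -- the Gram sum `Σ_x (Σ_i c_i g_i x)² = Σ_i c_i² Σ_x (g_i x)²` (orthogonality kills cross terms)
  have hgram : ∑ x, (∑ i, c i * g i x) ^ 2 = ∑ i, c i ^ 2 * ∑ x, g i x ^ 2 := by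
    calc ∑ x, (∑ i, c i * g i x) ^ 2
        = ∑ x, ∑ i, ∑ j, c i * g i x * (c j * g j x) :=
          Finset.sum_congr rfl fun x _ => by rw [sq, Finset.sum_mul_sum]
      _ = ∑ i, ∑ x, ∑ j, c i * g i x * (c j * g j x) := Finset.sum_comm
      _ = ∑ i, ∑ j, ∑ x, c i * g i x * (c j * g j x) :=
          Finset.sum_congr rfl fun i _ => Finset.sum_comm
      _ = ∑ i, ∑ j, c i * c j * ∑ x, g i x * g j x := by
          refine Finset.sum_congr rfl fun i _ => Finset.sum_congr rfl fun j _ => ?_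
          rw [Finset.mul_sum]
          exact Finset.sum_congr rfl fun x _ => by ring
      _ = ∑ i, c i ^ 2 * ∑ x, g i x ^ 2 := by
          refine Finset.sum_congr rfl fun i _ => ?_
          rw [Finset.sum_eq_single_of_mem i (Finset.mem_univ i) fun j _ hji => by
            rw [horth i j (Ne.symm hji), mul_zero]]
          simp only [sq]
  -- the cross sum `Σ_x f x (Σ_i c_i g_i x) = Σ_i c_i ⟨f, g_i⟩`
  have hcross : ∑ x, f x * ∑ i, c i * g i x = ∑ i, c i * ∑ x, f x * g i x := by
    calc ∑ x, f x * ∑ i, c i * g i x = ∑ x, ∑ i, c i * (f x * g i x) := by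
          refine Finset.sum_congr rfl fun x _ => ?_
          rw [Finset.mul_sum]
          exact Finset.sum_congr rfl fun i _ => by ring
      _ = ∑ i, ∑ x, c i * (f x * g i x) := Finset.sum_comm
      _ = ∑ i, c i * ∑ x, f x * g i x :=
          Finset.sum_congr rfl fun i _ => by rw [Finset.mul_sum]
  have key : ∑ x, (t * f x - ∑ i, c i * g i x) ^ 2 =
      t ^ 2 * ∑ x, f x ^ 2 - 2 * t * ∑ i, c i * ∑ x, f x * g i x +
        ∑ i, c i ^ 2 * ∑ x, g i x ^ 2 := by
    rw [← hcross, ← hgram, Finset.mul_sum, Finset.mul_sum, ← Finset.sum_sub_distrib,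
      ← Finset.sum_add_distrib]
    exact Finset.sum_congr rfl fun x _ => by ring
  have h0 : 0 ≤ ∑ x, (t * f x - ∑ i, c i * g i x) ^ 2 :=
    Finset.sum_nonneg fun x _ => sq_nonneg _
  rw [key] at h0
  linarith

/-- `Σ_w #{y ∈ Γ : T y = w} = |Γ|` (as a real sum of indicators). [folklore] -/
theorem gl2Flat_bessel_count_fibre_card_sum {X W : Type*} [Fintype W] [DecidableEq W]
    (Γ : Finset X) (T : X → W) :
    ∑ w, ∑ y ∈ Γ, (if w = T y then (1 : ℝ) else 0) = Γ.card := by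
  rw [Finset.sum_comm]
  simp

/-- `Σ_w #{y ∈ Γ : T y = w}² = #{(x, y) ∈ Γ² : T x = T y}` (as real sums of indicators).
[folklore] -/
theorem gl2Flat_bessel_count_fibre_sq_sum {X W : Type*} [Fintype W] [DecidableEq W]
    (Γ : Finset X) (T : X → W) :
    ∑ w, (∑ y ∈ Γ, (if w = T y then (1 : ℝ) else 0)) ^ 2 =
      ∑ x ∈ Γ, ∑ y ∈ Γ, (if T x = T y then (1 : ℝ) else 0) := by
  calc ∑ w, (∑ y ∈ Γ, (if w = T y then (1 : ℝ) else 0)) ^ 2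
      = ∑ w, ∑ x ∈ Γ, ∑ y ∈ Γ,
          (if w = T x then (1 : ℝ) else 0) * (if w = T y then (1 : ℝ) else 0) :=
        Finset.sum_congr rfl fun w _ => by rw [sq, Finset.sum_mul_sum]
    _ = ∑ x ∈ Γ, ∑ w, ∑ y ∈ Γ,
          (if w = T x then (1 : ℝ) else 0) * (if w = T y then (1 : ℝ) else 0) :=
        Finset.sum_comm
    _ = ∑ x ∈ Γ, ∑ y ∈ Γ, ∑ w,
          (if w = T x then (1 : ℝ) else 0) * (if w = T y then (1 : ℝ) else 0) :=
        Finset.sum_congr rfl fun x _ => Finset.sum_comm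
    _ = ∑ x ∈ Γ, ∑ y ∈ Γ, (if T x = T y then (1 : ℝ) else 0) := by
        refine Finset.sum_congr rfl fun x _ => Finset.sum_congr rfl fun y _ => ?_
        simp only [boole_mul, Finset.sum_ite_eq', Finset.mem_univ, if_true]

/-- For two distinct representatives `rᵢ ≠ rⱼ` among `(0, 1)`, `(1, t)` the pair map
`x ↦ (x rᵢ, x rⱼ)` on `2 × 2` matrices is injective (the matrix with columns `rᵢ, rⱼ` is
invertible). [folklore] -/
theorem gl2Flat_bessel_count_pair_injective {K : Type*} [Field K] {i j : Option K}
    (hij : i ≠ j) :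
    Function.Injective fun x : Matrix (Fin 2) (Fin 2) K =>
      (x.mulVec (i.elim ![0, 1] fun t => ![1, t]), x.mulVec (j.elim ![0, 1] fun t => ![1, t])) := by
  intro x y hxy
  simp only [Prod.mk.injEq] at hxy
  obtain ⟨h1, h2⟩ := hxy
  refine Matrix.ext fun a => ?_
  have e1 := congrFun h1 a
  have e2 := congrFun h2 a
  rcases i with _ | s <;> rcases j with _ | t
  · exact absurd rfl hij
  · simp [Matrix.mulVec, dotProduct, Fin.sum_univ_two] at e1 e2
    refine Fin.forall_fin_two.2 ⟨?_, e1⟩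
    linear_combination e2 - t * e1
  · simp [Matrix.mulVec, dotProduct, Fin.sum_univ_two] at e1 e2
    refine Fin.forall_fin_two.2 ⟨?_, e2⟩
    linear_combination e1 - s * e2
  · have hst : s ≠ t := fun h => hij (congrArg some h)
    simp [Matrix.mulVec, dotProduct, Fin.sum_univ_two] at e1 e2
    have h3 : (s - t) * (x a 1 - y a 1) = 0 := by linear_combination e1 - e2
    have h4 : x a 1 = y a 1 := by
      rcases mul_eq_zero.1 h3 with h | h
      · exact absurd (sub_eq_zero.1 h) hst
      · exact sub_eq_zero.1 h
    refine Fin.forall_fin_two.2 ⟨?_, h4⟩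
    linear_combination e1 - s * h4

/-- For `i ≠ j` the pair map `x ↦ (x rᵢ, x rⱼ)` is a bijection `M₂(K) → K² × K²` (injective
between finite sets of the same size `Q⁴`). [folklore] -/
theorem gl2Flat_bessel_count_pair_bijective {K : Type*} [Field K] [Fintype K] {i j : Option K}
    (hij : i ≠ j) :
    Function.Bijective fun x : Matrix (Fin 2) (Fin 2) K =>
      (x.mulVec (i.elim ![0, 1] fun t => ![1, t]), x.mulVec (j.elim ![0, 1] fun t => ![1, t])) := by
  rw [Fintype.bijective_iff_injective_and_card]
  refine ⟨gl2Flat_bessel_count_pair_injective hij, ?_⟩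
  rw [show Fintype.card (Matrix (Fin 2) (Fin 2) K) = Fintype.card (Fin 2 → Fin 2 → K) from rfl,
    Fintype.card_prod, Fintype.card_fun, Fintype.card_fun, Fintype.card_fin]
  ring

/-- Orthogonality of two direction partitions: for `i ≠ j` and any `φ ψ : K² → ℝ`,
`Σ_x φ(x rᵢ) ψ(x rⱼ) = (Σ_w φ w) (Σ_w ψ w)` (reindex along the pair bijection). [folklore] -/
theorem gl2Flat_bessel_count_pair_sum {K : Type*} [Field K] [Fintype K] {i j : Option K}
    (hij : i ≠ j) (φ ψ : (Fin 2 → K) → ℝ) :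
    ∑ x : Matrix (Fin 2) (Fin 2) K,
        φ (x.mulVec (i.elim ![0, 1] fun t => ![1, t])) *
          ψ (x.mulVec (j.elim ![0, 1] fun t => ![1, t])) =
      (∑ w, φ w) * ∑ w, ψ w := by
  rw [Finset.sum_mul_sum, ← Fintype.sum_prod_type']
  exact Fintype.sum_bijective _ (gl2Flat_bessel_count_pair_bijective hij) _
    (fun p => φ p.1 * ψ p.2) fun _ => rfl

/-- Equipartition: for every direction `rᵢ` and every `φ : K² → ℝ`,
`Σ_x φ(x rᵢ) = Q² Σ_w φ w`, i.e. every fibre of `x ↦ x rᵢ` has exactly `Q²` elements. [folklore] -/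
theorem gl2Flat_bessel_count_fibre_sum {K : Type*} [Field K] [Fintype K] (i : Option K)
    (φ : (Fin 2 → K) → ℝ) :
    ∑ x : Matrix (Fin 2) (Fin 2) K, φ (x.mulVec (i.elim ![0, 1] fun t => ![1, t])) =
      (Fintype.card K : ℝ) ^ 2 * ∑ w, φ w := by
  obtain ⟨j, hij⟩ : ∃ j : Option K, i ≠ j := by
    rcases i with _ | t
    · exact ⟨some 0, (Option.some_ne_none 0).symm⟩
    · exact ⟨none, Option.some_ne_none t⟩
  have h := gl2Flat_bessel_count_pair_sum hij φ (fun _ => 1)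
  simp only [mul_one, Finset.sum_const, Finset.card_univ, Fintype.card_fun, Fintype.card_fin,
    nsmul_eq_mul, mul_one, Nat.cast_pow] at h
  rw [h, mul_comm]

/-- **Reduction to the `Q + 1` directions.**  With `F u := #{(x, y) ∈ Γ² : x u = y u}`:
`Σ_u F u = |Γ|² + (Q - 1) Σ_{i : Option K} F rᵢ`, where `r none = (0, 1)`, `r (some t) = (1, t)`:
the direction `u = 0` gives `|Γ|²`, `F (a • u) = F u` for `a ≠ 0`, and every column
`{(0, b)} ∖ 0`, `{(a, b) : b}` (`a ≠ 0`) of `K²` consists of `Q - 1`, resp. is in bijection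
(`b = a t`) with, nonzero multiples of the representatives. [folklore] -/
theorem gl2Flat_bessel_count_directions {K : Type*} [Field K] [Fintype K] [DecidableEq K]
    (Γ : Finset (Matrix (Fin 2) (Fin 2) K)) :
    ∑ u : Fin 2 → K, ∑ x ∈ Γ, ∑ y ∈ Γ, (if x.mulVec u = y.mulVec u then (1 : ℝ) else 0) =
      (Γ.card : ℝ) ^ 2 + ((Fintype.card K : ℝ) - 1) *
        ∑ i : Option K, ∑ x ∈ Γ, ∑ y ∈ Γ,
          (if x.mulVec (i.elim ![0, 1] fun t => ![1, t]) =
              y.mulVec (i.elim ![0, 1] fun t => ![1, t]) then (1 : ℝ) else 0) := by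
  set F : (Fin 2 → K) → ℝ := fun u =>
    ∑ x ∈ Γ, ∑ y ∈ Γ, (if x.mulVec u = y.mulVec u then (1 : ℝ) else 0) with hF
  change ∑ u, F u = (Γ.card : ℝ) ^ 2 + ((Fintype.card K : ℝ) - 1) *
    ∑ i : Option K, F (i.elim ![0, 1] fun t => ![1, t])
  -- `F` is constant on punctured lines
  have hsmul : ∀ a : K, a ≠ 0 → ∀ v : Fin 2 → K, F (a • v) = F v := by
    intro a ha v
    simp only [hF, Matrix.mulVec_smul, smul_right_inj ha]
  -- the zero direction
  have h0 : F 0 = (Γ.card : ℝ) ^ 2 := by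
    simp [hF, sq]
  -- sum over `K²` as a double sum
  have h1 : ∑ u, F u = ∑ a : K, ∑ b : K, F ![a, b] := by
    rw [← Fintype.sum_prod_type']
    exact (Fintype.sum_equiv (finTwoArrowEquiv K).symm _ _ fun p => rfl).symm
  -- the column `a = 0`
  have hcol : ∑ b : K, F ![0, b] =
      (Γ.card : ℝ) ^ 2 + ((Fintype.card K : ℝ) - 1) * F ![0, 1] := by
    rw [← Finset.add_sum_erase _ _ (Finset.mem_univ (0 : K))]
    have e00 : (![0, 0] : Fin 2 → K) = 0 := by
      funext k; fin_cases k <;> rfl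
    have hb : ∀ b ∈ Finset.univ.erase (0 : K), F ![0, b] = F ![0, 1] := by
      intro b hb
      have hb0 : b ≠ 0 := Finset.ne_of_mem_erase hb
      have e0b : (![0, b] : Fin 2 → K) = b • ![0, 1] := by
        funext k; fin_cases k <;> simp
      rw [e0b, hsmul b hb0]
    rw [e00, h0, Finset.sum_congr rfl hb, Finset.sum_const, Finset.card_erase_of_mem
      (Finset.mem_univ _), Finset.card_univ, nsmul_eq_mul, Nat.cast_pred Fintype.card_pos]
  -- the columns `a ≠ 0`
  have hrow : ∀ a ∈ Finset.univ.erase (0 : K), ∑ b : K, F ![a, b] = ∑ t : K, F ![1, t] := by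
    intro a ha
    have ha0 : a ≠ 0 := Finset.ne_of_mem_erase ha
    symm
    refine Fintype.sum_bijective (a * ·) (mulLeft_bijective₀ a ha0) _ _ fun t => ?_
    have eat : (![a, a * t] : Fin 2 → K) = a • ![1, t] := by
      funext k; fin_cases k <;> simp
    show F ![1, t] = F ![a, a * t]
    rw [eat, hsmul a ha0]
  rw [h1, ← Finset.add_sum_erase _ _ (Finset.mem_univ (0 : K)), hcol, Finset.sum_congr rfl hrow,
    Finset.sum_const, Finset.card_erase_of_mem (Finset.mem_univ _), Finset.card_univ,
    nsmul_eq_mul, Nat.cast_pred Fintype.card_pos, Fintype.sum_option]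
  simp only [Option.elim_none, Option.elim_some]
  ring

/-- **Bessel bound for the direction counts.**  With `F_i := #{(x, y) ∈ Γ² : x rᵢ = y rᵢ}` for the
`Q + 1` representatives `rᵢ`: `Q Σ_i F_i ≤ Q³ |Γ| + |Γ|²`.  Bessel's inequality for the indicator
function of `Γ` against the orthogonal family `{1} ∪ {x ↦ Q² nᵢ(x rᵢ) - |Γ|}`
(`nᵢ(w) := #{y ∈ Γ : y rᵢ = w}`), whose inner products are `⟨f, gᵢ⟩ = Q² F_i - |Γ|²`,
`⟨gᵢ, gᵢ⟩ = Q⁴ (Q² F_i - |Γ|²)`. [folklore] -/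
theorem gl2Flat_bessel_count_rep_sum_le {K : Type*} [Field K] [Fintype K] [DecidableEq K]
    (Γ : Finset (Matrix (Fin 2) (Fin 2) K)) :
    (Fintype.card K : ℝ) * ∑ i : Option K, ∑ x ∈ Γ, ∑ y ∈ Γ,
        (if x.mulVec (i.elim ![0, 1] fun t => ![1, t]) =
            y.mulVec (i.elim ![0, 1] fun t => ![1, t]) then (1 : ℝ) else 0) ≤
      (Fintype.card K : ℝ) ^ 3 * Γ.card + (Γ.card : ℝ) ^ 2 := by
  -- notation: `T i x = x rᵢ`, `F i`, `N i w = nᵢ(w)`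
  set T : Option K → Matrix (Fin 2) (Fin 2) K → (Fin 2 → K) :=
    fun i x => x.mulVec (i.elim ![0, 1] fun t => ![1, t]) with hT
  set F : Option K → ℝ := fun i =>
    ∑ x ∈ Γ, ∑ y ∈ Γ, (if T i x = T i y then (1 : ℝ) else 0) with hF
  change (Fintype.card K : ℝ) * ∑ i, F i ≤ (Fintype.card K : ℝ) ^ 3 * Γ.card + (Γ.card : ℝ) ^ 2
  set N : Option K → (Fin 2 → K) → ℝ := fun i w =>
    ∑ y ∈ Γ, (if w = T i y then (1 : ℝ) else 0) with hN
  have hQpos : (0 : ℝ) < Fintype.card K := Nat.cast_pos.2 Fintype.card_pos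
  have hcardW : (Fintype.card (Fin 2 → K) : ℝ) = (Fintype.card K : ℝ) ^ 2 := by
    rw [Fintype.card_fun, Fintype.card_fin, Nat.cast_pow]
  have hcardV : (Fintype.card (Matrix (Fin 2) (Fin 2) K) : ℝ) = (Fintype.card K : ℝ) ^ 4 := by
    rw [show Fintype.card (Matrix (Fin 2) (Fin 2) K) = Fintype.card (Fin 2 → Fin 2 → K) from rfl,
      Fintype.card_fun, Fintype.card_fun, Fintype.card_fin, Nat.cast_pow, Nat.cast_pow]
    ring
  -- fibre identities
  have hN1 : ∀ i, ∑ w, N i w = Γ.card := fun i => gl2Flat_bessel_count_fibre_card_sum Γ (T i)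
  have hN2 : ∀ i, ∑ w, N i w ^ 2 = F i := fun i => gl2Flat_bessel_count_fibre_sq_sum Γ (T i)
  have hNF : ∀ i, ∑ x ∈ Γ, N i (T i x) = F i := fun i => rfl
  have hfib : ∀ i (φ : (Fin 2 → K) → ℝ),
      ∑ x, φ (T i x) = (Fintype.card K : ℝ) ^ 2 * ∑ w, φ w :=
    fun i φ => gl2Flat_bessel_count_fibre_sum i φ
  have hpair : ∀ i j, i ≠ j → ∀ φ ψ : (Fin 2 → K) → ℝ,
      ∑ x, φ (T i x) * ψ (T j x) = (∑ w, φ w) * ∑ w, ψ w :=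
    fun i j hij φ ψ => gl2Flat_bessel_count_pair_sum hij φ ψ
  -- centred fibre counts: mean zero, and their variance
  have hA : ∀ i, ∑ w, ((Fintype.card K : ℝ) ^ 2 * N i w - Γ.card) = 0 := by
    intro i
    rw [Finset.sum_sub_distrib, ← Finset.mul_sum, hN1, Finset.sum_const, Finset.card_univ,
      nsmul_eq_mul, hcardW]
    ring
  have hD : ∀ i, ∑ w, ((Fintype.card K : ℝ) ^ 2 * N i w - Γ.card) ^ 2 =
      (Fintype.card K : ℝ) ^ 2 * ((Fintype.card K : ℝ) ^ 2 * F i - (Γ.card : ℝ) ^ 2) := by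
    intro i
    have e : ∀ w, ((Fintype.card K : ℝ) ^ 2 * N i w - Γ.card) ^ 2 =
        (Fintype.card K : ℝ) ^ 4 * N i w ^ 2 - 2 * Γ.card * (Fintype.card K : ℝ) ^ 2 * N i w +
          (Γ.card : ℝ) ^ 2 := fun w => by ring
    simp only [e, Finset.sum_add_distrib, Finset.sum_sub_distrib, ← Finset.mul_sum, hN1, hN2,
      Finset.sum_const, Finset.card_univ, nsmul_eq_mul, hcardW]
    ring
  -- the test functions: `f = 1_Γ`, `g none = 1`, `g (some i) = Q² nᵢ(x rᵢ) - |Γ|`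
  set f : Matrix (Fin 2) (Fin 2) K → ℝ := fun x => if x ∈ Γ then 1 else 0 with hf
  set g : Option (Option K) → Matrix (Fin 2) (Fin 2) K → ℝ :=
    fun I x => I.elim 1 fun i => (Fintype.card K : ℝ) ^ 2 * N i (T i x) - Γ.card with hg
  have horth : ∀ I J, I ≠ J → ∑ x, g I x * g J x = 0 := by
    intro I J hIJ
    rcases I with _ | i <;> rcases J with _ | j
    · exact absurd rfl hIJ
    · simp only [hg, Option.elim_none, Option.elim_some, one_mul]
      have h := hfib j (fun w => (Fintype.card K : ℝ) ^ 2 * N j w - Γ.card)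
      rw [hA, mul_zero] at h
      exact h
    · simp only [hg, Option.elim_none, Option.elim_some, mul_one]
      have h := hfib i (fun w => (Fintype.card K : ℝ) ^ 2 * N i w - Γ.card)
      rw [hA, mul_zero] at h
      exact h
    · have hij : i ≠ j := fun h => hIJ (congrArg some h)
      simp only [hg, Option.elim_some]
      have h := hpair i j hij (fun w => (Fintype.card K : ℝ) ^ 2 * N i w - Γ.card)
        (fun w => (Fintype.card K : ℝ) ^ 2 * N j w - Γ.card)
      rw [hA, hA, mul_zero] at h
      exact h
  -- the inner products
  have hff : ∑ x, f x ^ 2 = Γ.card := by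
    simp only [hf, ite_pow, one_pow, zero_pow two_ne_zero, Finset.sum_boole, Finset.filter_univ_mem]
  have hf1 : ∑ x, f x * g none x = Γ.card := by
    simp only [hf, hg, Option.elim_none, mul_one, Finset.sum_boole, Finset.filter_univ_mem]
  have h11 : ∑ x, g none x ^ 2 = (Fintype.card K : ℝ) ^ 4 := by
    simp only [hg, Option.elim_none, one_pow, Finset.sum_const, Finset.card_univ, nsmul_eq_mul,
      mul_one, hcardV]
  have hfg : ∀ i, ∑ x, f x * g (some i) x =
      (Fintype.card K : ℝ) ^ 2 * F i - (Γ.card : ℝ) ^ 2 := by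
    intro i
    have e : ∀ x, f x * g (some i) x =
        if x ∈ Γ then (Fintype.card K : ℝ) ^ 2 * N i (T i x) - Γ.card else 0 := by
      intro x
      simp only [hf, hg, Option.elim_some, boole_mul]
    simp only [e, Finset.sum_ite_mem_eq, Finset.sum_sub_distrib, ← Finset.mul_sum, hNF,
      Finset.sum_const, nsmul_eq_mul]
    ring
  have hgg : ∀ i, ∑ x, g (some i) x ^ 2 =
      (Fintype.card K : ℝ) ^ 4 * ((Fintype.card K : ℝ) ^ 2 * F i - (Γ.card : ℝ) ^ 2) := by
    intro i
    simp only [hg, Option.elim_some]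
    have h := hfib i (fun w => ((Fintype.card K : ℝ) ^ 2 * N i w - Γ.card) ^ 2)
    rw [hD] at h
    refine h.trans ?_
    ring
  -- Bessel
  have hB := gl2Flat_bessel_count_bessel f g ((Fintype.card K : ℝ) ^ 4)
    (fun I => I.elim (Γ.card : ℝ) fun _ => 1) horth
  rw [Fintype.sum_option (α := Option K), Fintype.sum_option (α := Option K)] at hB
  simp only [Option.elim_none, Option.elim_some, hff, hf1, h11, hfg, hgg, one_mul, one_pow,
    Finset.sum_sub_distrib, Finset.sum_const, Finset.card_univ, Fintype.card_option, nsmul_eq_mul,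
    Nat.cast_add, Nat.cast_one, ← Finset.mul_sum] at hB
  have key : (Fintype.card K : ℝ) ^ 5 * ((Fintype.card K : ℝ) * ∑ i, F i) ≤
      (Fintype.card K : ℝ) ^ 5 * ((Fintype.card K : ℝ) ^ 3 * Γ.card + (Γ.card : ℝ) ^ 2) := by
    linarith [hB]
  exact le_of_mul_le_mul_left key (pow_pos hQpos 5)

/-- **Bessel count (flat-size lemma, ingredient (iii)).**  For a finite field `K` with `Q := |K|`
and `Γ ⊆ M₂(K)`, the number `N₂ := Σ_{u ∈ K²} #{(x, y) ∈ Γ² : x u = y u}` satisfies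
`Q · N₂ ≤ Q |Γ|² + (Q - 1) (|Γ|² + Q³ |Γ|)`: split off `u = 0`, group the nonzero directions into
the `Q + 1` punctured lines (`gl2Flat_bessel_count_directions`) and apply the Bessel bound
`Q Σ_i F_i ≤ Q³ |Γ| + |Γ|²` (`gl2Flat_bessel_count_rep_sum_le`).  Equality holds for
`Γ = M₂(K)`. [folklore] -/
theorem gl2Flat_bessel_count : ∀ {K : Type} [Field K] [Fintype K] [DecidableEq K]
    (Γ : Finset (Matrix (Fin 2) (Fin 2) K)),
    (Fintype.card K : ℝ) *
        ∑ u : Fin 2 → K, ∑ x ∈ Γ, ∑ y ∈ Γ, (if x.mulVec u = y.mulVec u then (1 : ℝ) else 0) ≤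
      (Fintype.card K : ℝ) * (Γ.card : ℝ) ^ 2 +
        ((Fintype.card K : ℝ) - 1) * ((Γ.card : ℝ) ^ 2 + (Fintype.card K : ℝ) ^ 3 * Γ.card) := by
  intro K _ _ _ Γ
  rw [gl2Flat_bessel_count_directions Γ]
  have h := gl2Flat_bessel_count_rep_sum_le Γ
  have hQ1 : (1 : ℝ) ≤ Fintype.card K := by exact_mod_cast Fintype.card_pos
  have h2 := mul_le_mul_of_nonneg_left h (sub_nonneg.2 hQ1)
  linarith [h2]

end Summit.MatrixMultiplication.MatrixMultiplication.Theorems.GradedDesignFamily.Negative
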